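import Summits.Ventures.PercRepro.C041ConeClassE

/-!
# ROW C-041 — THE MARKED PENDANT: marks at the anchor of the multigraph multiply the six-vector by
`v 1 ^ p * v 0 ^ q` (p6, gen 30; mine-3's THEOREM (PENDANT ZONE) with marks at the anchor, C-041.md §20 (b),
INBOX 14162 (ii))

`pendantM Z₁ u Z₂ a₂` is the pendant attachment of `C041PendantZone` in which the multigraph `Z₁` KEEPS its own marks
(`U₁` / `U₂`, the zone's marks `T₁` / `T₂` redirected as before).  When every mark of `Z₁` sits at its anchor `a`, the
marked pendant is — up to the two stray vertices — the zone `pendant Z₁ u Z₂ a₂` GLUED AT THE ANCHOR with the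
marked point `pointZone p q` (`p = #U₁`, `q = #U₂`): the embedding `emb` (`C041ZoneEmb`) sends the marks of `Z₁` to
the point's marks.  Hence, by gluing (`C041AnchorGlueSix`), the seed (`C041PointZone`) and stray-vertex invariance:

* **`sixVec_pendantM`** — `Π(pendantM) = Π(pendant) * v 1 ^ p * v 0 ^ q` at the anchor;
* `inCone_sixVec_pendantM`, `K4_pendantM`, `zoneCSConj_pendantM`, `zoneOCubeConj_pendantM` — the cone, (P), the
  one-anchor (CS) and the ZONE O-CUBE propagate through a marked pendant from `InCone (Π(Z₂))`;
* `isZe_pendantM` — the marked pendant of a member of the class `IsZe` (`C041ConeClassE`) is a member.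
-/

namespace PercRepro

namespace ZoneZ

namespace MarkedPendant

open ZoneData TreeClosure Pendant AnchorGlue PointZone Finset

variable {V₁ E₁ U₁ U₂ V₂ E₂ T₁ T₂ : Type} (Z₁ : ZoneData V₁ E₁ U₁ U₂) (u : V₁) (Z₂ : ZoneData V₂ E₂ T₁ T₂) (a₂ : V₂)

/-- THE MARKED PENDANT: the graph of `pendant Z₁ u Z₂ a₂`, the marks of `Z₁` kept, the marks of `Z₂` redirected. -/
noncomputable def pendantM : ZoneData (V₁ ⊕ V₂) (E₁ ⊕ E₂) (U₁ ⊕ T₁) (U₂ ⊕ T₂) where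
  fst := (pendant Z₁ u Z₂ a₂).fst
  snd := (pendant Z₁ u Z₂ a₂).snd
  at₁ := Sum.elim (fun i => Sum.inl (Z₁.at₁ i)) (fun t => red u a₂ (Z₂.at₁ t))
  at₂ := Sum.elim (fun j => Sum.inl (Z₁.at₂ j)) (fun t => red u a₂ (Z₂.at₂ t))

variable (a : V₁) [Fintype U₁] [Fintype U₂]

/-- The model of the marked pendant: the pendant glued at its anchor with the marked point carrying the marks of
`Z₁` (the anchor is `inl (inl a)`; `inl (inr a₂)` and `inr ()` are stray). -/
noncomputable abbrev model :
    ZoneData ((V₁ ⊕ V₂) ⊕ Unit) ((E₁ ⊕ E₂) ⊕ Empty) (T₁ ⊕ Fin (Fintype.card U₁)) (T₂ ⊕ Fin (Fintype.card U₂)) :=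
  glue (pendant Z₁ u Z₂ a₂) (Sum.inl a) (pointZone (Fintype.card U₁) (Fintype.card U₂)) ()

/-- THE EMBEDDING of the marked pendant into its model, when every mark of `Z₁` sits at the anchor `a`. -/
noncomputable def emb (h1 : ∀ i, Z₁.at₁ i = a) (h2 : ∀ j, Z₁.at₂ j = a) :
    ZoneEmb (pendantM Z₁ u Z₂ a₂) (model Z₁ u Z₂ a₂ a) where
  v := Sum.inl
  inj := Sum.inl_injective
  e := (Equiv.sumEmpty (E₁ ⊕ E₂) Empty).symm
  t₁ := (Equiv.sumComm U₁ T₁).trans ((Equiv.refl T₁).sumCongr (Fintype.equivFin U₁))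
  t₂ := (Equiv.sumComm U₂ T₂).trans ((Equiv.refl T₂).sumCongr (Fintype.equivFin U₂))
  fst_map := fun _ => rfl
  snd_map := fun _ => rfl
  at₁_map := fun m => by
    cases m with
    | inl i =>
      show red (Sum.inl a) () () = Sum.inl (Sum.inl (Z₁.at₁ i))
      rw [red_self, h1 i]
    | inr _ => rfl
  at₂_map := fun m => by
    cases m with
    | inl j =>
      show red (Sum.inl a) () () = Sum.inl (Sum.inl (Z₁.at₂ j))
      rw [red_self, h2 j]
    | inr _ => rfl

/-- The vertex map of the embedding. -/
theorem emb_v (h1 : ∀ i, Z₁.at₁ i = a) (h2 : ∀ j, Z₁.at₂ j = a) (x : V₁ ⊕ V₂) :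
    (emb Z₁ u Z₂ a₂ a h1 h2).v x = Sum.inl x := rfl

/-- The model is a member of the class whenever `Z₂` is. -/
theorem isZe_model (h : IsZe Z₂ a₂) : IsZe (model Z₁ u Z₂ a₂ a) (Sum.inl (Sum.inl a)) :=
  IsZe.glue _ _ _ _ (IsZe.pendant Z₁ u a Z₂ a₂ h) (IsZe.oneVertex _ () (fun _ => rfl) (fun _ => rfl) ())

/-- **The marked pendant of a member of the class is a member** (every mark of `Z₁` at the anchor). -/
theorem isZe_pendantM (h1 : ∀ i, Z₁.at₁ i = a) (h2 : ∀ j, Z₁.at₂ j = a) (h : IsZe Z₂ a₂) :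
    IsZe (pendantM Z₁ u Z₂ a₂) (Sum.inl a) :=
  IsZe.embDown (Sum.inl a) (emb Z₁ u Z₂ a₂ a h1 h2) (isZe_model Z₁ u Z₂ a₂ a h)

section Six

variable [Fintype E₁] [DecidableEq E₁] [Fintype E₂] [DecidableEq E₂] [Fintype T₁] [DecidableEq T₁]
  [Fintype T₂] [DecidableEq T₂] [DecidableEq U₁] [DecidableEq U₂]

/-- **MARKS AT THE ANCHOR MULTIPLY THE SIX-VECTOR**: `Π(pendantM) = Π(pendant) * v 1 ^ #U₁ * v 0 ^ #U₂`. -/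
theorem sixVec_pendantM (h1 : ∀ i, Z₁.at₁ i = a) (h2 : ∀ j, Z₁.at₂ j = a) :
    (pendantM Z₁ u Z₂ a₂).sixVec (Sum.inl a) =
      (pendant Z₁ u Z₂ a₂).sixVec (Sum.inl a) * v 1 ^ Fintype.card U₁ * v 0 ^ Fintype.card U₂ := by
  rw [← (emb Z₁ u Z₂ a₂ a h1 h2).sixVec_eq (Sum.inl a)]
  show (model Z₁ u Z₂ a₂ a).sixVec (Sum.inl (Sum.inl a)) = _
  rw [sixVec_glue, sixVec_pointZone, one_mul, mul_assoc]

/-- The cone propagates through a marked pendant. -/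
theorem inCone_sixVec_pendantM (h1 : ∀ i, Z₁.at₁ i = a) (h2 : ∀ j, Z₁.at₂ j = a) (h : InCone (Z₂.sixVec a₂)) :
    InCone ((pendantM Z₁ u Z₂ a₂).sixVec (Sum.inl a)) := by
  rw [← (emb Z₁ u Z₂ a₂ a h1 h2).inCone_iff (Sum.inl a)]
  exact inCone_sixVec_glue _ _ _ _ (inCone_sixVec_pendant Z₁ u Z₂ a₂ a h) (inCone_sixVec_pointZone _ _)

/-- (P) propagates through a marked pendant. -/
theorem K4_pendantM (h1 : ∀ i, Z₁.at₁ i = a) (h2 : ∀ j, Z₁.at₂ j = a) (h : InCone (Z₂.sixVec a₂)) :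
    K4 (#((pendantM Z₁ u Z₂ a₂).Fset (Sum.inl a)) : ℝ) (#((pendantM Z₁ u Z₂ a₂).T1set (Sum.inl a)))
      (#((pendantM Z₁ u Z₂ a₂).T2set (Sum.inl a))) (#((pendantM Z₁ u Z₂ a₂).Iset (Sum.inl a))) :=
  (pendantM Z₁ u Z₂ a₂).K4_of_inCone_sixVec _ (inCone_sixVec_pendantM Z₁ u Z₂ a₂ a h1 h2 h)

/-- The one-anchor (CS) propagates through a marked pendant. -/
theorem zoneCSConj_pendantM (h1 : ∀ i, Z₁.at₁ i = a) (h2 : ∀ j, Z₁.at₂ j = a) (h : InCone (Z₂.sixVec a₂)) :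
    (pendantM Z₁ u Z₂ a₂).ZoneCSConj {Sum.inl a} (∅ : Set (V₁ ⊕ V₂)) :=
  (pendantM Z₁ u Z₂ a₂).zoneCSConj_of_inCone_sixVec _ (inCone_sixVec_pendantM Z₁ u Z₂ a₂ a h1 h2 h)

/-- The ZONE O-CUBE propagates through a marked pendant. -/
theorem zoneOCubeConj_pendantM (h1 : ∀ i, Z₁.at₁ i = a) (h2 : ∀ j, Z₁.at₂ j = a) (h : InCone (Z₂.sixVec a₂)) :
    (pendantM Z₁ u Z₂ a₂).ZoneOCubeConj {Sum.inl a} (∅ : Set (V₁ ⊕ V₂)) :=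
  (pendantM Z₁ u Z₂ a₂).zoneOCubeConj_of_inCone_sixVec _ (inCone_sixVec_pendantM Z₁ u Z₂ a₂ a h1 h2 h)

end Six

end MarkedPendant

end ZoneZ

end PercRepro
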